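import Summits.QuantumFields.YangMills.Theses.StiffComplementSchur
import HarnessLib

/-!
# `StiffComplementSchur.Assembly` (item stmt-QuantumFields-23300) — PROVED:
# `StiffPenalty → LastScaleKernelP → SchurEnclosureP → FemtoTransferGap.FemtoGapOfRecord`

Route `StiffComplementSchur` (D-0145 LINE g16-A of seat ym-idea-4, rev 1; draft-by-design onto the rung leaf R2b1
`FemtoTransferGap.FemtoGapOfRecord`).  The Assembly is exactly the shape of the route's deciding theorem: the support
item `SchurEnclosureP` turns the two cruxes into the tree leaf `FemtoTransferGap.RunningReduction`, and the PROVED seam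
`FemtoTransferGap.femtoGapOfRecord_of_reduction` together with the CLOSED one-site leaf `FemtoTransferGap.oneSiteLevels_proof`
gives the rung leaf.

HONEST FRAMING: pure glue (one term); the cruxes `StiffPenalty`, `LastScaleKernelP` and the support `SchurEnclosureP` are OPEN;
no summit / rung statement is proved; the YM mass gap is NOT proved.  No `sorry`, no new axiom, no new definition.
References: [cite: Luscher1983, §3]; [cite: GustafsonSigal2003, §11.1].
-/

set_option autoImplicit false

namespace Summit.QuantumFields.YangMills.Theorems.StiffComplementSchur

/-- **Assembly of route `StiffComplementSchur`** (item stmt-QuantumFields-23300):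
`StiffPenalty → LastScaleKernelP → SchurEnclosureP → FemtoTransferGap.FemtoGapOfRecord`, by the seam
`femtoGapOfRecord_of_reduction oneSiteLevels_proof` applied to `RunningReduction := h₃ h₁ h₂`. -/
theorem assembly_proof : Summit.QuantumFields.YangMills.Theses.StiffComplementSchur.Assembly := by
  intro h₁ h₂ h₃
  exact Summit.QuantumFields.YangMills.Theorems.FemtoTransferGap.femtoGapOfRecord_of_reduction
    Summit.QuantumFields.YangMills.Theorems.FemtoTransferGap.oneSiteLevels_proof (h₃ h₁ h₂)

end Summit.QuantumFields.YangMills.Theorems.StiffComplementSchur
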